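import Summits.CriticalPhenomena.PercolationContinuityZ3.Theorems.Transplant.FKConnectivityAllQK5DisjCertDefs
import Mathlib.Data.Nat.Bitwise
import Mathlib.Algebra.BigOperators.Group.Finset.Basic
import Mathlib.Algebra.BigOperators.Ring.Finset
import Mathlib.Algebra.Order.BigOperators.Group.Finset
import Mathlib.Algebra.Order.BigOperators.Ring.Finset
import Mathlib.Algebra.BigOperators.Group.List.Basic
import Mathlib.Data.Real.Basic
import Mathlib.Tactic.Linarith
import Mathlib.Tactic.Positivity
import Mathlib.Tactic.Ring
import HarnessLib

/-!
# `K₅` is Potts–Rayleigh (`0 < q ≤ 1`), disjoint pairs — file 2: masks, submasks, fiber constants, FIBER REGROUPING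

Helper file (`--supports stmt-CriticalPhenomena-4575`), FK sub-lane `prim-bschramm-fk-3` (gen 11) of the post-continuity programme;
builds on p205010 (kernel theorem, internal audit signed; external expert review pending).  No named facts, no sorries; standard axioms.

THE THEOREM OF THIS CHAIN (`…K5Disj`): **`K₅` is Potts–Rayleigh for every `0 < q ≤ 1`** — the random-cluster measure `φ_{w,q}` on every
weighted graph with at most five vertices is edge-negatively associated, `φ(J_e ∩ J_f) ≤ φ(J_e)φ(J_f)` for ALL pairs `e ≠ f` (adjacent pairs:
gen 10, `…K5`; this chain: the disjoint pairs, one `S₅`-orbit, `(e, f) = (01, 23)`).  Wagner 2008, Ex. 5.2 records Sokal's computation for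
`K₄`; for `K₅` the Rayleigh difference `Z¹⁰Z⁰¹ − Z⁰⁰Z¹¹` of `(01, 23)` has negative coefficients that no binomial (AM–GM) square repairs
(gen 10, LP scoping), so the certificate is a SUM OF GRAM SQUARES: with `y` the odds parameters of the eight pairs `E₈' = K₅ − {01, 23}`,
the reduced difference `D̂ = (Z¹⁰Z⁰¹ − Z⁰⁰Z¹¹)/(q²(1−q))` (degree `4` in `q`) is written in the scaled Bernstein basis
`Σ_{j ≤ 4} B̃_j(y) q^j (1−q)^{4−j}`, and each slice `B̃_j` is certified `≥ 0` on the orthant as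
`B̃_j = Σ_T y^T · m_Tᵀ H_{T,j} m_T + (nonnegative coefficients)`, `|T| ≤ 2`, `m_T` the multi-affine monomials off `T` inside the
Newton polytope, `H_{T,j} = U K Uᵀ` integer positive semidefinite (witness `s²K = LLᵀ + E`, `E` diagonally dominant).  The certificates
were found by semidefinite programming, facial reduction and integer rounding OUTSIDE Lean (bschramm/FK-BARRIER.md §15) and are CHECKED
HERE BY THE KERNEL (`decide +kernel`), fiber by fiber (`3^8 = 6561` fibers per slice).
[cite: Wagner2006, Ex. 5.2, Conj. 5.3, Thm. 5.8 (p. 13)] [cite: Grimmett2006, §3.9 eq. (3.94), Conj. (3.96) (pp. 63–66); §1.4 eq. (1.20) (p. 15)]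

THIS FILE (pure algebra over masks `m < 256`, no measures): the submask enumeration of the checker is the filter of `range 256`
(`decide`); the bit-arithmetic facts relating a pair code `c = m₁ + 256 m₂` to its fiber `(m₁ ∧ m₂, m₁ ∨ m₂)` and back (`decide`
over all `65536` codes / all fibers); the product weight `vW` of a configuration and the fiber constant `cW`; `vW(m₁)vW(m₂) = cW(fiber)`;
and the **fiber regrouping** `Σ_{m₁,m₂} vW vW X = Σ_{I ⊆ J} cW(I,J) Σ_{S ⊆ J∖I} X(I+S, J−S)` (the mask form of fk-1 g6's fiber
decomposition, `…HubCovFiber`).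
-/

noncomputable section

namespace Summit.CriticalPhenomena.PercolationContinuityZ3.Theorems

namespace FK

namespace K5D

open Finset

/-- `submasks d` is the list of `S < 256` with `S ∧ d = S` (for `d < 256`). [folklore] -/
theorem submasks_eq_filter : ∀ d ∈ List.range 256, submasks d = (List.range 256).filter fun S => S &&& d == S := by
  have h : ((List.range 256).all fun d => submasks d == (List.range 256).filter fun S => S &&& d == S) = true := by
    decide +kernel
  intro d hd
  exact eq_of_beq ((List.all_eq_true.1 h) d hd)

/-- membership in `submasks d`: the submasks `S < 256` of `d`. [folklore] -/
theorem mem_submasks {d S : ℕ} (hd : d < 256) : S ∈ submasks d ↔ S < 256 ∧ S &&& d = S := by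
  rw [submasks_eq_filter d (List.mem_range.2 hd), List.mem_filter, List.mem_range]
  simp

/-- `submasks d` has no duplicates. [folklore] -/
theorem nodup_submasks {d : ℕ} (hd : d < 256) : (submasks d).Nodup := by
  rw [submasks_eq_filter d (List.mem_range.2 hd)]
  exact (List.nodup_range).filter _

/-- key code of a pair code `c = m₁ + 256 m₂`: `(m₁ ∧ m₂) + 256 (m₁ ∨ m₂)` -/
def keyC (c : ℕ) : ℕ := (c % 256 &&& c / 256) + 256 * (c % 256 ||| c / 256)

/-- the Boolean body of decide-fact D1 -/
def pairFactB (c : ℕ) : Bool :=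
  decide ((c % 256 &&& c / 256) < 256) && decide ((c % 256 ||| c / 256) < 256) && decide (keyC c < 65536) &&
      (keyC c % 256 == (c % 256 &&& c / 256)) && (keyC c / 256 == (c % 256 ||| c / 256)) &&
      ((c % 256 &&& c / 256) &&& (c % 256 ||| c / 256) == (c % 256 &&& c / 256)) &&
      decide (c % 256 - (c % 256 &&& c / 256) < 256) &&
      ((c % 256 - (c % 256 &&& c / 256)) &&& ((c % 256 ||| c / 256) - (c % 256 &&& c / 256)) == c % 256 - (c % 256 &&& c / 256)) &&
      (((c % 256 &&& c / 256) + (c % 256 - (c % 256 &&& c / 256))) + 256 * ((c % 256 ||| c / 256) - (c % 256 - (c % 256 &&& c / 256))) == c)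

set_option maxHeartbeats 0 in
/-- decide-fact D1, first half. [folklore] -/
theorem pair_facts_bool₁ : ((List.range' 0 32768).all pairFactB) = true := by decide +kernel

set_option maxHeartbeats 0 in
/-- decide-fact D1, second half. [folklore] -/
theorem pair_facts_bool₂ : ((List.range' 32768 32768).all pairFactB) = true := by decide +kernel

/-- decide-fact D1 on all pair codes `< 65536`. [folklore] -/
theorem pair_facts_bool : ∀ c ∈ List.range 65536, pairFactB c = true := by
  intro c hc
  have hc' := List.mem_range.1 hc
  by_cases h : c < 32768
  · exact (List.all_eq_true.1 pair_facts_bool₁) c (List.mem_range'_1.2 ⟨by omega, by omega⟩)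
  · exact (List.all_eq_true.1 pair_facts_bool₂) c (List.mem_range'_1.2 ⟨by omega, by omega⟩)

/-- decide-fact D1 (pair codes). [folklore] -/
theorem pair_facts : ∀ c ∈ List.range 65536,
    (c % 256 &&& c / 256) < 256 ∧ (c % 256 ||| c / 256) < 256 ∧ keyC c < 65536 ∧
    keyC c % 256 = (c % 256 &&& c / 256) ∧ keyC c / 256 = (c % 256 ||| c / 256) ∧
    ((c % 256 &&& c / 256) &&& (c % 256 ||| c / 256) = (c % 256 &&& c / 256)) ∧
    (c % 256 - (c % 256 &&& c / 256)) ∈ submasks ((c % 256 ||| c / 256) - (c % 256 &&& c / 256)) ∧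
    ((c % 256 &&& c / 256) + (c % 256 - (c % 256 &&& c / 256))) + 256 * ((c % 256 ||| c / 256) - (c % 256 - (c % 256 &&& c / 256))) = c := by
  intro c hc
  have := pair_facts_bool c hc
  unfold pairFactB at this
  simp only [Bool.and_eq_true, decide_eq_true_eq, beq_iff_eq] at this
  obtain ⟨⟨⟨⟨⟨⟨⟨⟨a, b⟩, c'⟩, d⟩, e⟩, f⟩, g1⟩, g2⟩, h⟩ := this
  have hd : (c % 256 ||| c / 256) - (c % 256 &&& c / 256) < 256 := by omega
  exact ⟨a, b, c', d, e, f, (mem_submasks hd).2 ⟨g1, g2⟩, h⟩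

/-- the Boolean body of decide-fact D2 -/
def fiberFactB (J : ℕ) : Bool :=
  (List.range 256).all fun I => !(I &&& J == I) ||
      (submasks (J - I)).all fun S => decide ((I + S) + 256 * (J - S) < 65536) && (((I + S) + 256 * (J - S)) % 256 == I + S) &&
        (((I + S) + 256 * (J - S)) / 256 == J - S) && ((I + S) &&& (J - S) == I) && (((I + S) ||| (J - S)) == J) && (I + S - I == S)

set_option maxHeartbeats 0 in
/-- decide-fact D2, first half. [folklore] -/
theorem fiber_facts_bool₁ : ((List.range' 0 128).all fiberFactB) = true := by decide +kernel

set_option maxHeartbeats 0 in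
/-- decide-fact D2, second half. [folklore] -/
theorem fiber_facts_bool₂ : ((List.range' 128 128).all fiberFactB) = true := by decide +kernel

/-- decide-fact D2 on all `J < 256`. [folklore] -/
theorem fiber_facts_bool : ∀ J ∈ List.range 256, fiberFactB J = true := by
  intro J hJ
  have hJ' := List.mem_range.1 hJ
  by_cases h : J < 128
  · exact (List.all_eq_true.1 fiber_facts_bool₁) J (List.mem_range'_1.2 ⟨by omega, by omega⟩)
  · exact (List.all_eq_true.1 fiber_facts_bool₂) J (List.mem_range'_1.2 ⟨by omega, by omega⟩)

/-- decide-fact D2 (fibers and submasks). [folklore] -/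
theorem fiber_facts : ∀ J ∈ List.range 256, ∀ I ∈ List.range 256, I &&& J = I → ∀ S ∈ submasks (J - I),
    (I + S) + 256 * (J - S) < 65536 ∧ ((I + S) + 256 * (J - S)) % 256 = I + S ∧ ((I + S) + 256 * (J - S)) / 256 = J - S ∧
    (I + S) &&& (J - S) = I ∧ ((I + S) ||| (J - S)) = J ∧ I + S - I = S := by
  intro J hJ I hI hIJ S hS
  have h := fiber_facts_bool J hJ
  unfold fiberFactB at h
  have := (List.all_eq_true.1 h) I hI
  rw [Bool.or_eq_true] at this
  rcases this with hno | hall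
  · simp [hIJ] at hno
  · have := (List.all_eq_true.1 hall) S hS
    simp only [Bool.and_eq_true, decide_eq_true_eq, beq_iff_eq] at this
    obtain ⟨⟨⟨⟨⟨a, b⟩, c⟩, d⟩, e⟩, f⟩ := this
    exact ⟨a, b, c, d, e, f⟩

/-- double sum over `range A × range B` as a single sum over codes `a + A·b`. [folklore] -/
theorem sum_sum_range_eq_sum_code {M : Type*} [AddCommMonoid M] (A B : ℕ) (hA : 0 < A) (f : ℕ → ℕ → M) :
    ∑ b ∈ range B, ∑ a ∈ range A, f a b = ∑ c ∈ range (A * B), f (c % A) (c / A) := by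
  induction B with
  | zero => simp
  | succ B ih =>
    rw [Finset.sum_range_succ, ih, Nat.mul_succ, Finset.sum_range_add]
    congr 1
    refine Finset.sum_congr rfl fun a ha => ?_
    have ha' : a < A := mem_range.1 ha
    rw [Nat.add_comm, Nat.add_mul_mod_self_left, Nat.add_mul_div_left _ _ hA, Nat.mod_eq_of_lt ha', Nat.div_eq_of_lt ha',
      Nat.zero_add]

variable (u : Fin 8 → ℝ)

/-- product weight of a configuration mask -/
noncomputable def vW (m : ℕ) : ℝ := ∏ i : Fin 8, if m.testBit i then u i else 1 - u i
/-- fiber constant of a fiber `(I, J)` (masks) -/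
noncomputable def cW (I J : ℕ) : ℝ :=
  ∏ i : Fin 8, if I.testBit i then u i * u i else if J.testBit i then u i * (1 - u i) else (1 - u i) * (1 - u i)

/-- `vW(m₁)·vW(m₂)` is the fiber constant of `(m₁ ∧ m₂, m₁ ∨ m₂)`. [folklore] -/
theorem vW_mul_vW (m₁ m₂ : ℕ) : vW u m₁ * vW u m₂ = cW u (m₁ &&& m₂) (m₁ ||| m₂) := by
  unfold vW cW
  rw [← Finset.prod_mul_distrib]
  refine Finset.prod_congr rfl fun i _ => ?_
  rw [Nat.testBit_land, Nat.testBit_lor]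
  cases m₁.testBit i <;> cases m₂.testBit i <;> simp [mul_comm]

/-- `vW ≥ 0` on `[0,1]⁸`. [folklore] -/
theorem vW_nonneg (h0 : ∀ i, 0 ≤ u i) (h1 : ∀ i, u i ≤ 1) (m : ℕ) : 0 ≤ vW u m := by
  unfold vW
  refine Finset.prod_nonneg fun i _ => ?_
  have ha := h0 i; have hb := h1 i
  split_ifs
  · exact ha
  · linarith

/-- `cW ≥ 0` on `[0,1]⁸`. [folklore] -/
theorem cW_nonneg (h0 : ∀ i, 0 ≤ u i) (h1 : ∀ i, u i ≤ 1) (I J : ℕ) : 0 ≤ cW u I J := by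
  unfold cW
  refine Finset.prod_nonneg fun i _ => ?_
  have ha := h0 i; have hb := h1 i
  split_ifs
  · exact mul_nonneg ha ha
  · exact mul_nonneg ha (by linarith)
  · exact mul_nonneg (by linarith) (by linarith)

/-- list sum over `submasks` as a finset sum -/
theorem sum_submasks_eq {d : ℕ} (hd : d < 256) (g : ℕ → ℝ) :
    ((submasks d).map g).sum = ∑ S ∈ (submasks d).toFinset, g S := by
  rw [List.sum_toFinset _ (nodup_submasks hd)]

/-- the inner fiber sum over the pair codes with a given key is the submask sum. [folklore] -/
theorem sum_fiber_eq_sum_submasks (X : ℕ → ℕ → ℝ) {I J : ℕ} (hI : I < 256) (hJ : J < 256) (hsub : I &&& J = I) :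
    ∑ c ∈ (range 65536).filter (fun c => keyC c = I + 256 * J), vW u (c % 256) * vW u (c / 256) * X (c % 256) (c / 256) =
      cW u I J * ((submasks (J - I)).map fun S => X (I + S) (J - S)).sum := by
  have hd : J - I < 256 := by omega
  rw [sum_submasks_eq hd, Finset.mul_sum]
  have hkI : (I + 256 * J) % 256 = I := by omega
  have hkJ : (I + 256 * J) / 256 = J := by omega
  refine Finset.sum_nbij' (fun c => c % 256 - I) (fun S => (I + S) + 256 * (J - S)) ?_ ?_ ?_ ?_ ?_
  · intro c hc
    rw [Finset.mem_filter] at hc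
    obtain ⟨h1, hkey⟩ := hc
    have hf := pair_facts c (List.mem_range.2 (Finset.mem_range.1 h1))
    have e1 : (c % 256 &&& c / 256) = I := by rw [← hf.2.2.2.1, hkey, hkI]
    have e2 : (c % 256 ||| c / 256) = J := by rw [← hf.2.2.2.2.1, hkey, hkJ]
    rw [List.mem_toFinset]
    have hm := hf.2.2.2.2.2.2.1
    rw [e1, e2] at hm
    exact hm
  · intro S hS
    rw [List.mem_toFinset] at hS
    have hf := fiber_facts J (List.mem_range.2 hJ) I (List.mem_range.2 hI) hsub S hS
    rw [Finset.mem_filter]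
    refine ⟨mem_range.2 hf.1, ?_⟩
    unfold keyC
    rw [hf.2.1, hf.2.2.1, hf.2.2.2.1, hf.2.2.2.2.1]
  · intro c hc
    rw [Finset.mem_filter] at hc
    obtain ⟨h1, hkey⟩ := hc
    have hf := pair_facts c (List.mem_range.2 (Finset.mem_range.1 h1))
    have e1 : (c % 256 &&& c / 256) = I := by rw [← hf.2.2.2.1, hkey, hkI]
    have e2 : (c % 256 ||| c / 256) = J := by rw [← hf.2.2.2.2.1, hkey, hkJ]
    have hr := hf.2.2.2.2.2.2.2
    rw [e1, e2] at hr
    exact hr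
  · intro S hS
    rw [List.mem_toFinset] at hS
    have hf := fiber_facts J (List.mem_range.2 hJ) I (List.mem_range.2 hI) hsub S hS
    rw [hf.2.1, hf.2.2.2.2.2]
  · intro c hc
    rw [Finset.mem_filter] at hc
    obtain ⟨h1, hkey⟩ := hc
    have hf := pair_facts c (List.mem_range.2 (Finset.mem_range.1 h1))
    have e1 : (c % 256 &&& c / 256) = I := by rw [← hf.2.2.2.1, hkey, hkI]
    have e2 : (c % 256 ||| c / 256) = J := by rw [← hf.2.2.2.2.1, hkey, hkJ]
    have hr := hf.2.2.2.2.2.2.2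
    rw [e1, e2] at hr
    -- hr : I + (c%256 - I) + 256 * (J - (c%256 - I)) = c
    rw [vW_mul_vW, e1, e2]
    have em1 : I + (c % 256 - I) = c % 256 := by omega
    have em2 : J - (c % 256 - I) = c / 256 := by omega
    rw [em1, em2]

/-- fibers over keys not of the form `I ⊆ J` are empty. [folklore] -/
theorem sum_fiber_eq_zero (g : ℕ → ℝ) {I J : ℕ} (hI : I < 256) (hsub : ¬ I &&& J = I) :
    ∑ c ∈ (range 65536).filter (fun c => keyC c = I + 256 * J), g c = 0 := by
  refine Finset.sum_eq_zero fun c hc => ?_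
  exfalso
  rw [Finset.mem_filter] at hc
  obtain ⟨h1, hkey⟩ := hc
  have hf := pair_facts c (List.mem_range.2 (Finset.mem_range.1 h1))
  have hkI : (I + 256 * J) % 256 = I := by omega
  have hkJ : (I + 256 * J) / 256 = J := by omega
  have e1 : (c % 256 &&& c / 256) = I := by rw [← hf.2.2.2.1, hkey, hkI]
  have e2 : (c % 256 ||| c / 256) = J := by rw [← hf.2.2.2.2.1, hkey, hkJ]
  have h3 := hf.2.2.2.2.2.1
  rw [e1, e2] at h3
  exact hsub h3

/-- **Fiber regrouping**: a double sum of product weights regrouped over the fibers `(I ⊆ J)` and the submasks of `J − I`.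
[folklore] -/
theorem sum_pairs_eq_sum_fibers (X : ℕ → ℕ → ℝ) :
    ∑ m₂ ∈ range 256, ∑ m₁ ∈ range 256, vW u m₁ * vW u m₂ * X m₁ m₂ =
      ∑ J ∈ range 256, ∑ I ∈ range 256,
        if I &&& J = I then cW u I J * ((submasks (J - I)).map fun S => X (I + S) (J - S)).sum else 0 := by
  rw [sum_sum_range_eq_sum_code 256 256 (by norm_num) (fun m₁ m₂ => vW u m₁ * vW u m₂ * X m₁ m₂)]
  rw [sum_sum_range_eq_sum_code 256 256 (by norm_num) (fun I J =>
    if I &&& J = I then cW u I J * ((submasks (J - I)).map fun S => X (I + S) (J - S)).sum else 0)]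
  have hmaps : ∀ c ∈ range (256 * 256), keyC c ∈ range (256 * 256) := fun c hc =>
    mem_range.2 (pair_facts c (List.mem_range.2 (Finset.mem_range.1 hc))).2.2.1
  rw [← Finset.sum_fiberwise_of_maps_to hmaps]
  refine Finset.sum_congr rfl fun κ hκ => ?_
  have hκ' : κ < 65536 := mem_range.1 hκ
  have hI : κ % 256 < 256 := Nat.mod_lt _ (by norm_num)
  have hJ : κ / 256 < 256 := by omega
  have hsplit : κ = κ % 256 + 256 * (κ / 256) := by omega
  by_cases hsub : κ % 256 &&& κ / 256 = κ % 256
  · rw [if_pos hsub, ← sum_fiber_eq_sum_submasks u X hI hJ hsub, ← hsplit]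
  · rw [if_neg hsub]
    have := sum_fiber_eq_zero (fun c => vW u (c % 256) * vW u (c / 256) * X (c % 256) (c / 256)) hI hsub
    rw [← hsplit] at this
    exact this

end K5D

end FK

end Summit.CriticalPhenomena.PercolationContinuityZ3.Theorems

end
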